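import Mathlib
import Summits.Parity.GeneralizedHardyLittlewood.Theorems.ParityLeakOneFifthPlainSplitTwistedCellSieve
import HarnessLib

/-!
# Route ParityLeakOneFifth, crux `ParityLeakSieve` (stmt-Parity-18381), skeleton `birth`:
# the sieve step for `Ω`-cells twisted by a fixed rough divisor `P`

For stub S2 (`stub_parityDefectZero`, the corner count of the zero-parity-defect census) one must
count the `z`-rough `m ∈ (x, 2x]` whose shift factors as `m + 2 = P·b` with `P` a FIXED `Y`-rough
number and `b` in an `Ω`-cell of the `Y`-rough integers, `Φ_{i+1}(·, Y) = {b : P⁻(b) ≥ ⌈Y⌉, Ω(b) = i+1}`.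
This file proves the sieve step `twistedCellP_sieve_le` (the case `P = 1` is
`twistedCell_sieve_le` of the sister crux `PlainSplit`): the count is at most
`(#Φ_{i+1}(⌊(2x+2)/P⌋, Y) − #Φ_{i+1}(⌊(x+2)/P⌋, Y))·V_sh(z)·(1 + C₁e^{−log L/log z}) + C₂Σ_{X} X/(log X)^A`
(`X = ⌊(2x+2)/P⌋, ⌊(x+2)/P⌋`), for `2 < z ≤ L`, `z ≤ Y ≤ ⌊(x+2)/P⌋`, `log⌊(2x+2)/P⌋ ≤ n log Y`,
`L ≤ ⌊(x+2)/P⌋^{1/4}`: the uniform fundamental lemma for the sequence `1[m ∈ (x,2x], m+2 = Pb, b ∈ Φ]`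
with the shifted-primes density `1/φ(d)` (odd `d`), whose remainders are differences of class
discrepancies of the cell in the class `c_d ≡ 2·P⁻¹ (mod d)` (`c_d = 2·P^{φ(d)−1} mod d`, written inline), bounded on
average by the tree's Bombieri–Vinogradov theorem for `Ω`-cells
`RoughCellsAP.exists_sum_abs_cellClassDisc_le`.
-/

namespace Summit.Parity.GeneralizedHardyLittlewood.Theorems.ParityLeakOneFifth

open Finset Real
open scoped ArithmeticFunction.Omega
open Literature.NumberTheory.Sieve

/-! ### The residue `c_d = 2·P^{φ(d)−1} mod d` -/

/-- The class `c_q` of `b` with `P·b ≡ 2 (mod q)` — `c_q = 2·P^{φ(q)−1} mod q` when `(q, 2P) = 1`,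
else `1` — is prime to `q`. -/
theorem twistClass_coprime (P q : ℕ) :
    (if q.Coprime (2 * P) then (2 * P ^ (Nat.totient q - 1)) % q else 1).Coprime q := by
  split_ifs with h
  · have h2 : Nat.Coprime 2 q := (Nat.Coprime.coprime_mul_right_right h).symm
    have hP : Nat.Coprime P q := (Nat.Coprime.coprime_mul_left_right h).symm
    have hc : Nat.Coprime (2 * P ^ (Nat.totient q - 1)) q := Nat.Coprime.mul_left h2 (hP.pow_left _)
    unfold Nat.Coprime at hc ⊢
    rw [← Nat.gcd_rec, Nat.gcd_comm]
    exact hc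
  · exact Nat.coprime_one_left q

/-- For `(q, 2P) = 1`, `q > 0`: `P·b ≡ 2 (mod q)` iff `b ≡ c_q (mod q)`. -/
theorem modEq_mul_iff_modEq_twistClass {P q : ℕ} (hq : 0 < q) (hcop : q.Coprime (2 * P)) (b : ℕ) :
    Nat.ModEq q (P * b) 2 ↔
      Nat.ModEq q b (if q.Coprime (2 * P) then (2 * P ^ (Nat.totient q - 1)) % q else 1) := by
  rw [if_pos hcop]
  have hP : Nat.Coprime P q := (Nat.Coprime.coprime_mul_left_right hcop).symm
  have hφ : 1 ≤ Nat.totient q := Nat.totient_pos.2 hq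
  obtain ⟨t, ht⟩ : ∃ t : ℕ, Nat.totient q = t + 1 := ⟨_, (Nat.sub_add_cancel hφ).symm⟩
  have hkey : Nat.ModEq q (P * ((2 * P ^ (Nat.totient q - 1)) % q)) 2 := by
    have h1 : Nat.ModEq q (P * ((2 * P ^ (Nat.totient q - 1)) % q)) (P * (2 * P ^ (Nat.totient q - 1))) :=
      Nat.ModEq.mul_left P (Nat.mod_modEq _ _)
    refine h1.trans ?_
    have e : P * (2 * P ^ (Nat.totient q - 1)) = 2 * P ^ Nat.totient q := by
      rw [ht, Nat.add_sub_cancel, pow_succ]; ring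
    rw [e]
    have h2 := (Nat.ModEq.pow_totient hP).mul_left 2
    rwa [mul_one] at h2
  constructor
  · intro h
    have h3 : Nat.ModEq q (P * b) (P * ((2 * P ^ (Nat.totient q - 1)) % q)) := h.trans hkey.symm
    exact Nat.ModEq.cancel_left_of_coprime (by rw [Nat.gcd_comm]; exact hP) h3
  · intro h
    exact (Nat.ModEq.mul_left P h).trans hkey

/-! ### The sifted sequence `1[m ∈ (x, 2x], m + 2 = P b, b ∈ Φ_{i+1}(⌊(2x+2)/P⌋, N)]` -/

/-- The sifted sum of the `P`-twisted cell sequence is the twisted count. -/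
theorem cellSeqP_sifted_eq (x i N P : ℕ) (z : ℝ) (A : SieveSequence)
    (hA : ∀ m : ℕ, A.a m = if m ∈ Finset.Ioc x (2 * x) ∧ P ∣ m + 2 ∧ (m + 2) / P ∈
      (roughIcc N ((2 * x + 2) / P)).filter (fun b : ℕ => ArithmeticFunction.cardFactors b = i + 1)
      then 1 else 0) :
    A.sifted (2 * (x : ℝ)) (primesProdBelow z) =
      #((Finset.Ioc x (2 * x)).filter (fun m : ℕ => (∀ p ∈ m.primeFactors, z ≤ (p : ℝ)) ∧
          P ∣ m + 2 ∧ N ≤ ((m + 2) / P).minFac ∧ ArithmeticFunction.cardFactors ((m + 2) / P) = i + 1)) := by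
  rw [SieveSequence.sifted, show ((2 * (x : ℝ))) = ((2 * x : ℕ) : ℝ) by push_cast; ring,
    Nat.floor_natCast]
  simp only [hA]
  rw [Finset.sum_ite, Finset.sum_const_zero, add_zero, Finset.sum_const, nsmul_eq_mul, mul_one]
  congr 1
  apply congrArg
  ext m
  simp only [Finset.mem_filter, Finset.mem_Ioc, mem_roughIcc]
  constructor
  · rintro ⟨⟨⟨-, -⟩, hcop⟩, ⟨hx1, hx2⟩, hPd, ⟨⟨-, hr⟩, hΩ⟩⟩
    have hm0 : m ≠ 0 := by omega
    have hk2 : 2 ≤ (m + 2) / P := by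
      by_contra h
      rw [not_le] at h
      interval_cases hk : (m + 2) / P <;> simp [ArithmeticFunction.cardFactors_one] at hΩ
    refine ⟨⟨hx1, hx2⟩, (rough_iff_coprime hm0 z).2 hcop, hPd, ?_, hΩ⟩
    exact (forall_primeFactors_le_iff hk2).1 fun p hp =>
      hr p (Nat.prime_of_mem_primeFactors hp) (Nat.dvd_of_mem_primeFactors hp)
  · rintro ⟨⟨hx1, hx2⟩, hrough, hPd, hmin, hΩ⟩
    have hm0 : m ≠ 0 := by omega
    have hk0 : (m + 2) / P ≠ 0 := by
      intro h; rw [h] at hΩ; simp at hΩ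
    refine ⟨⟨⟨by omega, hx2⟩, (rough_iff_coprime hm0 z).1 hrough⟩, ⟨hx1, hx2⟩, hPd,
      ⟨⟨Nat.pos_of_ne_zero hk0, Nat.div_le_div_right (by omega)⟩, ?_⟩, hΩ⟩
    intro p hp hpd
    have hk2 : 2 ≤ (m + 2) / P := by
      by_contra h
      rw [not_le] at h
      interval_cases hk : (m + 2) / P
      · exact hk0 rfl
      · simp [ArithmeticFunction.cardFactors_one] at hΩ
    exact ((forall_primeFactors_le_iff hk2).2 hmin) p (Nat.mem_primeFactors.2 ⟨hp, hpd, hk0⟩)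

/-- The congruence sums of the `P`-twisted cell sequence at a modulus `d` prime to `2P`:
`A_d(2x) = #{b ∈ Φ(⌊(2x+2)/P⌋) : b ≡ c_d (d), ⌊(x+2)/P⌋ < b}`. -/
theorem cellSeqP_congrSum_eq (x i N P : ℕ) (hP : 0 < P) (A : SieveSequence)
    (hA : ∀ m : ℕ, A.a m = if m ∈ Finset.Ioc x (2 * x) ∧ P ∣ m + 2 ∧ (m + 2) / P ∈
      (roughIcc N ((2 * x + 2) / P)).filter (fun b : ℕ => ArithmeticFunction.cardFactors b = i + 1)
      then 1 else 0) {d : ℕ} (hd : 0 < d) (hcop : d.Coprime (2 * P)) :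
    A.congrSum d (2 * (x : ℝ)) =
      #(((roughIcc N ((2 * x + 2) / P)).filter (fun b : ℕ => ArithmeticFunction.cardFactors b = i + 1)).filter
        (fun b : ℕ => Nat.ModEq d b ((if d.Coprime (2 * P) then (2 * P ^ (Nat.totient d - 1)) % d else 1)) ∧ (x + 2) / P < b)) := by
  rw [SieveSequence.congrSum, show ((2 * (x : ℝ))) = ((2 * x : ℕ) : ℝ) by push_cast; ring,
    Nat.floor_natCast]
  simp only [hA]
  rw [Finset.sum_ite, Finset.sum_const_zero, add_zero, Finset.sum_const, nsmul_eq_mul, mul_one]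
  congr 1
  refine Finset.card_bij (fun m _ => (m + 2) / P) ?_ ?_ ?_
  · intro m hm
    simp only [Finset.mem_filter, Finset.mem_Ioc] at hm ⊢
    obtain ⟨⟨⟨-, -⟩, hdm⟩, ⟨hx1, hx2⟩, hPd, hcell⟩ := hm
    have e := Nat.mul_div_cancel' hPd
    refine ⟨hcell, ?_, ?_⟩
    · rw [← modEq_mul_iff_modEq_twistClass hd hcop, e]
      exact ((Nat.modEq_iff_dvd' (by omega : 2 ≤ m + 2)).2 (by simpa using hdm)).symm
    · by_contra h
      rw [not_lt] at h
      have := Nat.mul_le_mul_left P h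
      rw [e] at this
      have h2 := Nat.div_mul_le_self (x + 2) P
      rw [mul_comm] at h2
      omega
  · intro m₁ hm₁ m₂ hm₂ h
    simp only [Finset.mem_filter] at hm₁ hm₂
    have e₁ := Nat.mul_div_cancel' hm₁.2.2.1
    have e₂ := Nat.mul_div_cancel' hm₂.2.2.1
    have : m₁ + 2 = m₂ + 2 := by rw [← e₁, ← e₂, h]
    omega
  · intro b hb
    simp only [Finset.mem_filter] at hb
    obtain ⟨hcell, hmod, hxb⟩ := hb
    have hbM : b ≤ (2 * x + 2) / P := (mem_roughIcc.1 hcell.1).1.2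
    have hPb : P * b ≤ 2 * x + 2 := by
      have := Nat.mul_le_mul_left P hbM
      exact this.trans (Nat.mul_div_le (2 * x + 2) P)
    have hPb' : x + 2 < P * b := by
      by_contra h
      rw [not_lt] at h
      have : b ≤ (x + 2) / P := by
        rw [Nat.le_div_iff_mul_le hP, mul_comm]; exact h
      omega
    refine ⟨P * b - 2, ?_, ?_⟩
    · simp only [Finset.mem_filter, Finset.mem_Ioc]
      have e : P * b - 2 + 2 = P * b := by omega
      have hdvd : d ∣ P * b - 2 := by
        have h1 := (modEq_mul_iff_modEq_twistClass hd hcop b).2 hmod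
        exact (Nat.modEq_iff_dvd' (by omega : 2 ≤ P * b)).1 h1.symm
      refine ⟨⟨⟨by omega, by omega⟩, hdvd⟩, ⟨by omega, by omega⟩, ⟨b, e⟩, ?_⟩
      rw [e, Nat.mul_div_cancel_left b hP]; exact hcell
    · show (P * b - 2 + 2) / P = b
      rw [show P * b - 2 + 2 = P * b by omega, Nat.mul_div_cancel_left b hP]

/-- The congruence sum vanishes at even moduli when the cell is odd (`N ≥ 3`) and `P` is odd. -/
theorem cellSeqP_congrSum_even (x i N P : ℕ) (hN : 3 ≤ N) (hPodd : ¬ 2 ∣ P) (A : SieveSequence)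
    (hA : ∀ m : ℕ, A.a m = if m ∈ Finset.Ioc x (2 * x) ∧ P ∣ m + 2 ∧ (m + 2) / P ∈
      (roughIcc N ((2 * x + 2) / P)).filter (fun b : ℕ => ArithmeticFunction.cardFactors b = i + 1)
      then 1 else 0) {d : ℕ} (h2 : 2 ∣ d) :
    A.congrSum d (2 * (x : ℝ)) = 0 := by
  rw [SieveSequence.congrSum, show ((2 * (x : ℝ))) = ((2 * x : ℕ) : ℝ) by push_cast; ring,
    Nat.floor_natCast]
  refine Finset.sum_eq_zero fun m hm => ?_
  rw [hA]
  split_ifs with h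
  · exfalso
    obtain ⟨-, hPd, hcell⟩ := h
    rw [Finset.mem_filter] at hm hcell
    have hdm : 2 ∣ m := h2.trans hm.2
    have h2m : 2 ∣ m + 2 := Nat.dvd_add hdm (dvd_refl 2)
    have e := Nat.mul_div_cancel' hPd
    have h2b : 2 ∣ (m + 2) / P := by
      rw [← e] at h2m
      exact (Nat.Prime.dvd_mul Nat.prime_two).1 h2m |>.resolve_left hPodd
    exact odd_of_mem_roughIcc hcell.1 hN h2b
  · rfl

/-- The remainder of the `P`-twisted cell sequence (density `1/φ` on odd moduli, size the cell's
window count) at an odd modulus `d` prime to `P` whose prime factors are `< N` is the difference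
of the class discrepancies of the cell at heights `⌊(2x+2)/P⌋` and `⌊(x+2)/P⌋` in the class `c_d`. -/
theorem cellSeqP_remainder_odd (x i N P : ℕ) (hP : 0 < P) (A : SieveSequence)
    (hA : ∀ m : ℕ, A.a m = if m ∈ Finset.Ioc x (2 * x) ∧ P ∣ m + 2 ∧ (m + 2) / P ∈
      (roughIcc N ((2 * x + 2) / P)).filter (fun b : ℕ => ArithmeticFunction.cardFactors b = i + 1)
      then 1 else 0)
    (hdens : A.density = shiftedPrimesDensity 2)
    (hsize : A.size (2 * (x : ℝ)) =
      (#((roughIcc N ((2 * x + 2) / P)).filter (fun b : ℕ => ArithmeticFunction.cardFactors b = i + 1)) : ℝ) -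
      #((roughIcc N ((x + 2) / P)).filter (fun b : ℕ => ArithmeticFunction.cardFactors b = i + 1)))
    {d : ℕ} (hd : 0 < d) (hcop : d.Coprime (2 * P)) (hdN : ∀ p : ℕ, p.Prime → p ∣ d → p < N) :
    A.remainder d (2 * (x : ℝ)) =
      ((((#((roughIcc N ((2 * x + 2) / P)).filter (fun b : ℕ => ArithmeticFunction.cardFactors b = i + 1 ∧ Nat.ModEq d b ((if d.Coprime (2 * P) then (2 * P ^ (Nat.totient d - 1)) % d else 1))))) : ℕ) : ℝ) - (((#((roughIcc N ((2 * x + 2) / P)).filter (fun b : ℕ => ArithmeticFunction.cardFactors b = i + 1 ∧ b.Coprime d))) : ℕ) : ℝ) / ((Nat.totient d : ℕ) : ℝ)) -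
      ((((#((roughIcc N ((x + 2) / P)).filter (fun b : ℕ => ArithmeticFunction.cardFactors b = i + 1 ∧ Nat.ModEq d b ((if d.Coprime (2 * P) then (2 * P ^ (Nat.totient d - 1)) % d else 1))))) : ℕ) : ℝ) - (((#((roughIcc N ((x + 2) / P)).filter (fun b : ℕ => ArithmeticFunction.cardFactors b = i + 1 ∧ b.Coprime d))) : ℕ) : ℝ) / ((Nat.totient d : ℕ) : ℝ)) := by
  have hcop2 : d.Coprime 2 := Nat.Coprime.coprime_mul_right_right hcop
  have hdensd : A.density d = ((Nat.totient d : ℕ) : ℝ)⁻¹ := by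
    rw [hdens, shiftedPrimesDensity_apply, if_pos ⟨hcop2, hd.ne'⟩]
  rw [SieveSequence.remainder, cellSeqP_congrSum_eq x i N P hP A hA hd hcop, hdensd, hsize]
  have hM : (x + 2) / P ≤ (2 * x + 2) / P := Nat.div_le_div_right (by omega)
  have hwin := card_cell_window N ((2 * x + 2) / P) ((x + 2) / P) hM
    (fun b : ℕ => ArithmeticFunction.cardFactors b = i + 1) (fun b : ℕ => Nat.ModEq d b ((if d.Coprime (2 * P) then (2 * P ^ (Nat.totient d - 1)) % d else 1)))
  have hcopM : ∀ M : ℕ, (roughIcc N M).filter (fun b : ℕ =>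
      ArithmeticFunction.cardFactors b = i + 1 ∧ b.Coprime d) =
      (roughIcc N M).filter (fun b : ℕ => ArithmeticFunction.cardFactors b = i + 1) := by
    intro M
    ext b
    simp only [Finset.mem_filter]
    constructor
    · rintro ⟨hr, hΩ, -⟩; exact ⟨hr, hΩ⟩
    · rintro ⟨hr, hΩ⟩
      exact ⟨hr, hΩ, Summit.Parity.BatemanHorn.Cruxes.OddSectorShareLinear.Birth.SieveDecouplingOdd.coprime_of_mem_roughIcc
        hr hdN⟩
  have hff : ∀ M : ℕ, (roughIcc N M).filter (fun b : ℕ =>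
      ArithmeticFunction.cardFactors b = i + 1 ∧ Nat.ModEq d b ((if d.Coprime (2 * P) then (2 * P ^ (Nat.totient d - 1)) % d else 1))) =
      ((roughIcc N M).filter (fun b : ℕ => ArithmeticFunction.cardFactors b = i + 1)).filter
        (fun b : ℕ => Nat.ModEq d b ((if d.Coprime (2 * P) then (2 * P ^ (Nat.totient d - 1)) % d else 1))) := by
    intro M; rw [Finset.filter_filter]
  rw [hcopM, hcopM, hff, hff, ← hwin]
  ring

/-! ### The sieve step -/

/-- **Sieve step for `Ω`-cells twisted by a fixed rough divisor.** For every `i, n` and real `A`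
there are `C₁ > 0`, `C₂ ≥ 0` such that for all `x, P : ℕ` (`P ≥ 1`) and reals `z, L, Y` with
`2 < z ≤ L`, `z ≤ Y`, every prime factor of `P` at least `Y`, `Y ≤ ⌊(x+2)/P⌋`,
`log⌊(2x+2)/P⌋ ≤ n·log Y` and `L ≤ ⌊(x+2)/P⌋^{1/4}`: the number of `m ∈ (x, 2x]` with `m` `z`-rough,
`P ∣ m + 2`, `P⁻((m+2)/P) ≥ ⌈Y⌉` and `Ω((m+2)/P) = i+1` is at most
`(#Φ_{i+1}(⌊(2x+2)/P⌋, Y) − #Φ_{i+1}(⌊(x+2)/P⌋, Y))·V_sh(z)·(1 + C₁e^{−log L/log z}) + C₂Σ_{X} X/(log X)^A`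
(`X = ⌊(2x+2)/P⌋, ⌊(x+2)/P⌋`; `Φ_{i+1}(X, Y) = {b ∈ roughIcc ⌈Y⌉ X : Ω b = i+1}`). -/
theorem twistedCellP_sieve_le (i n : ℕ) (A : ℝ) :
    ∃ C₁ C₂ : ℝ, 0 < C₁ ∧ 0 ≤ C₂ ∧ ∀ (x P : ℕ) (z L Y : ℝ), 0 < P → 2 < z → z ≤ L → z ≤ Y →
      (∀ p : ℕ, p.Prime → p ∣ P → Y ≤ (p : ℝ)) →
      Y ≤ (((x + 2) / P : ℕ) : ℝ) → Real.log (((2 * x + 2) / P : ℕ) : ℝ) ≤ n * Real.log Y →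
      L ≤ (((x + 2) / P : ℕ) : ℝ) ^ ((1 : ℝ) / 4) →
      (#((Finset.Ioc x (2 * x)).filter (fun m : ℕ => (∀ p ∈ m.primeFactors, z ≤ (p : ℝ)) ∧
          P ∣ m + 2 ∧ ⌈Y⌉₊ ≤ ((m + 2) / P).minFac ∧
          ArithmeticFunction.cardFactors ((m + 2) / P) = i + 1)) : ℝ) ≤
        ((#((roughIcc ⌈Y⌉₊ ((2 * x + 2) / P)).filter
            (fun b => ArithmeticFunction.cardFactors b = i + 1)) : ℝ) -
          #((roughIcc ⌈Y⌉₊ ((x + 2) / P)).filter (fun b => ArithmeticFunction.cardFactors b = i + 1))) *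
          (∏ p ∈ (Finset.range ⌈z⌉₊).filter (fun p : ℕ => p.Prime ∧ p ≠ 2), (1 - 1 / ((p : ℝ) - 1))) *
          (1 + C₁ * Real.exp (-(Real.log L / Real.log z))) +
        (C₂ * (((2 * x + 2) / P : ℕ) : ℝ) / Real.log (((2 * x + 2) / P : ℕ) : ℝ) ^ A +
          C₂ * (((x + 2) / P : ℕ) : ℝ) / Real.log (((x + 2) / P : ℕ) : ℝ) ^ A) := by
  obtain ⟨K, hdim⟩ := hasSieveDimension_shiftedPrimes_two_one_holds
  obtain ⟨C₁, hC₁, hFL⟩ := SieveSequence.fundamental_lemma_uniform_holds 1 K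
  obtain ⟨C₂, hC₂, hBV⟩ := RoughCellsAP.exists_sum_abs_cellClassDisc_le n A
  refine ⟨C₁, C₂, hC₁, hC₂, ?_⟩
  intro x P z L Y hP hz2 hzL hzY hPY hYx hlogn hL4
  set N : ℕ := ⌈Y⌉₊ with hN
  set M₂ : ℕ := (2 * x + 2) / P with hM₂
  set M₁ : ℕ := (x + 2) / P with hM₁
  have hM : M₁ ≤ M₂ := Nat.div_le_div_right (by omega)
  have hN3 : 3 ≤ N := by
    rw [hN]; exact Nat.lt_ceil.2 (by push_cast; linarith)
  have hY2 : 2 ≤ Y := by linarith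
  have hYX1 : Y ≤ ((M₁ : ℕ) : ℝ) := hYx
  have hYX2 : Y ≤ ((M₂ : ℕ) : ℝ) := hYx.trans (by exact_mod_cast hM)
  have hM₁pos : (0 : ℝ) < (M₁ : ℝ) := by linarith
  have hlog2 : Real.log ((M₂ : ℕ) : ℝ) ≤ n * Real.log Y := hlogn
  have hlog1 : Real.log ((M₁ : ℕ) : ℝ) ≤ n * Real.log Y :=
    le_trans (Real.log_le_log hM₁pos (by exact_mod_cast hM)) hlogn
  -- `P` is odd and prime to every `d ∣ P(z)`
  have hPodd : ¬ 2 ∣ P := by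
    intro h
    have := hPY 2 Nat.prime_two h
    norm_num at this
    linarith
  have hsmall : ∀ d : ℕ, d ∣ primesProdBelow z → ∀ p : ℕ, p.Prime → p ∣ d → p < N := by
    intro d hd p hp hpd
    have hpz : (p : ℝ) < z := (dvd_primesProdBelow_iff hp z).1 (hpd.trans hd)
    rw [hN]; exact Nat.lt_ceil.2 (hpz.trans_le hzY)
  have hcopP : ∀ d : ℕ, d ∣ primesProdBelow z → ¬ 2 ∣ d → d.Coprime (2 * P) := by
    intro d hd h2
    refine Nat.Coprime.mul_right (Nat.prime_two.coprime_iff_not_dvd.2 h2).symm ?_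
    refine Nat.coprime_of_dvd fun p hp hpd hpP => ?_
    have hpz : (p : ℝ) < z := (dvd_primesProdBelow_iff hp z).1 (hpd.trans hd)
    have := hPY p hp hpP
    linarith
  -- the level is below `X^{1/4}` at both heights
  have hsubset : ∀ M : ℕ, M₁ ≤ M →
      (primesProdBelow z).divisors.filter (fun d : ℕ => (d : ℝ) ≤ L) ⊆
        Finset.Icc 1 ⌊((M : ℕ) : ℝ) ^ ((1 : ℝ) / 4)⌋₊ := by
    intro M hMM d hd
    have hd' := Finset.mem_filter.1 hd
    have hM'' : ((M₁ : ℕ) : ℝ) ≤ (M : ℝ) := by exact_mod_cast hMM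
    have hM' : ((M₁ : ℕ) : ℝ) ^ ((1 : ℝ) / 4) ≤ ((M : ℕ) : ℝ) ^ ((1 : ℝ) / 4) :=
      Real.rpow_le_rpow (by positivity) hM'' (by norm_num)
    exact Finset.mem_Icc.2 ⟨Nat.pos_of_mem_divisors hd'.1,
      Nat.le_floor (hd'.2.trans (hL4.trans hM'))⟩
  -- the sequence
  set sz : ℝ := (#((roughIcc N M₂).filter
      (fun b : ℕ => ArithmeticFunction.cardFactors b = i + 1)) : ℝ) -
    #((roughIcc N M₁).filter (fun b : ℕ => ArithmeticFunction.cardFactors b = i + 1)) with hsz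
  have hsz0 : 0 ≤ sz := by
    rw [hsz, sub_nonneg]
    exact_mod_cast Finset.card_le_card (Finset.filter_subset_filter _ (roughIcc_mono N hM))
  let 𝒜 : SieveSequence :=
    { a := fun m => if m ∈ Finset.Ioc x (2 * x) ∧ P ∣ m + 2 ∧ (m + 2) / P ∈ (roughIcc N M₂).filter
          (fun b : ℕ => ArithmeticFunction.cardFactors b = i + 1) then 1 else 0
      a_nonneg := fun m => by positivity
      size := fun _ => sz
      density := shiftedPrimesDensity 2
      density_mult := isMultiplicative_shiftedPrimesDensity 2 }
  have hA : ∀ m : ℕ, 𝒜.a m = if m ∈ Finset.Ioc x (2 * x) ∧ P ∣ m + 2 ∧ (m + 2) / P ∈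
      (roughIcc N M₂).filter (fun b : ℕ => ArithmeticFunction.cardFactors b = i + 1)
      then 1 else 0 := fun m => rfl
  have hdimA : HasSieveDimension 𝒜.density 1 K := hdim
  have hdensA : 𝒜.densityProduct (primesProdBelow z) =
      ∏ p ∈ (Finset.range ⌈z⌉₊).filter (fun p : ℕ => p.Prime ∧ p ≠ 2), (1 - 1 / ((p : ℝ) - 1)) :=
    densityProduct_shiftedPrimes_two z
  -- residues for Bombieri–Vinogradov
  set c : ℕ → ℕ := fun q => (if q.Coprime (2 * P) then (2 * P ^ (Nat.totient q - 1)) % q else 1)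
    with hc
  have hcq : ∀ q : ℕ, 0 < q → (c q).Coprime q := fun q _ => twistClass_coprime P q
  set disc : ℕ → ℕ → ℝ := fun M d =>
    ((#((roughIcc N M).filter (fun b : ℕ => ArithmeticFunction.cardFactors b = i + 1 ∧
        Nat.ModEq d b (c d))) : ℕ) : ℝ) -
      ((#((roughIcc N M).filter (fun b : ℕ => ArithmeticFunction.cardFactors b = i + 1 ∧
        b.Coprime d)) : ℕ) : ℝ) / ((Nat.totient d : ℕ) : ℝ) with hdisc
  -- remainders termwise
  have hremd : ∀ d ∈ (primesProdBelow z).divisors.filter (fun d : ℕ => (d : ℝ) ≤ L),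
      |𝒜.remainder d (2 * (x : ℝ))| ≤ |disc M₂ d| + |disc M₁ d| := by
    intro d hd
    have hdv := (Nat.mem_divisors.1 (Finset.mem_filter.1 hd).1).1
    have hd0 : 0 < d := Nat.pos_of_mem_divisors (Finset.mem_filter.1 hd).1
    by_cases h2 : 2 ∣ d
    · have hdens0 : 𝒜.density d = 0 := by
        show shiftedPrimesDensity 2 d = 0
        rw [shiftedPrimesDensity_apply, if_neg]
        rintro ⟨hc', -⟩
        have : ¬ 2 ∣ d := (Nat.prime_two.coprime_iff_not_dvd.1 hc'.symm)
        exact this h2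
      rw [SieveSequence.remainder, cellSeqP_congrSum_even x i N P hN3 hPodd 𝒜 hA h2, hdens0]
      simp only [zero_mul, sub_zero, abs_zero]
      positivity
    · rw [cellSeqP_remainder_odd x i N P hP 𝒜 hA rfl rfl hd0 (hcopP d hdv h2) (hsmall d hdv)]
      exact abs_sub _ _
  -- summing with Bombieri–Vinogradov for the cells
  have hBV2 := hBV ((M₂ : ℕ) : ℝ) Y hY2 hYX2 hlog2 i c hcq
  have hBV1 := hBV ((M₁ : ℕ) : ℝ) Y hY2 hYX1 hlog1 i c hcq
  rw [Nat.floor_natCast] at hBV2 hBV1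
  have hrem : ∑ d ∈ (primesProdBelow z).divisors.filter (fun d : ℕ => (d : ℝ) ≤ L),
      |𝒜.remainder d (2 * (x : ℝ))| ≤
      C₂ * ((M₂ : ℕ) : ℝ) / Real.log ((M₂ : ℕ) : ℝ) ^ A +
        C₂ * ((M₁ : ℕ) : ℝ) / Real.log ((M₁ : ℕ) : ℝ) ^ A := by
    refine (Finset.sum_le_sum hremd).trans ?_
    rw [Finset.sum_add_distrib]
    have s2 := Finset.sum_le_sum_of_subset_of_nonneg (hsubset M₂ hM)
      (f := fun d => |disc M₂ d|) (fun _ _ _ => abs_nonneg _)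
    have s1 := Finset.sum_le_sum_of_subset_of_nonneg (hsubset M₁ le_rfl)
      (f := fun d => |disc M₁ d|) (fun _ _ _ => abs_nonneg _)
    have e2 : ∑ d ∈ Finset.Icc 1 ⌊((M₂ : ℕ) : ℝ) ^ ((1 : ℝ) / 4)⌋₊, |disc M₂ d| ≤
        C₂ * ((M₂ : ℕ) : ℝ) / Real.log ((M₂ : ℕ) : ℝ) ^ A := by
      simpa only [hdisc] using hBV2
    have e1 : ∑ d ∈ Finset.Icc 1 ⌊((M₁ : ℕ) : ℝ) ^ ((1 : ℝ) / 4)⌋₊, |disc M₁ d| ≤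
        C₂ * ((M₁ : ℕ) : ℝ) / Real.log ((M₁ : ℕ) : ℝ) ^ A := by
      simpa only [hdisc] using hBV1
    linarith
  -- the fundamental lemma
  have hmain := hFL 𝒜 hdimA (2 * (x : ℝ)) z L hz2.le hzL (show (0 : ℝ) ≤ sz from hsz0)
  rw [cellSeqP_sifted_eq x i N P z 𝒜 hA, hdensA] at hmain
  have hup := (abs_le.1 hmain).2
  have hsize : 𝒜.size (2 * (x : ℝ)) = sz := rfl
  rw [hsize] at hup
  have e : sz * (∏ p ∈ (Finset.range ⌈z⌉₊).filter (fun p : ℕ => p.Prime ∧ p ≠ 2),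
      (1 - 1 / ((p : ℝ) - 1))) * (1 + C₁ * Real.exp (-(Real.log L / Real.log z))) =
      sz * (∏ p ∈ (Finset.range ⌈z⌉₊).filter (fun p : ℕ => p.Prime ∧ p ≠ 2),
        (1 - 1 / ((p : ℝ) - 1))) +
      C₁ * sz * (∏ p ∈ (Finset.range ⌈z⌉₊).filter (fun p : ℕ => p.Prime ∧ p ≠ 2),
        (1 - 1 / ((p : ℝ) - 1))) * Real.exp (-(Real.log L / Real.log z)) := by ring
  rw [e]
  linarith

end Summit.Parity.GeneralizedHardyLittlewood.Theorems.ParityLeakOneFifth
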